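import Literature.Combinatorics.Optimization.PsdLiftSlackMatrix
import Literature.LinearAlgebra.Matrix.SpectrahedralConeExtremeRays
import Literature.Analysis.Convex.CubeOctahedronDuality
import HarnessLib

/-!
# Chains of faces obstruct small psd lifts (Fawzi–Gouveia–Parrilo–Saunderson–Thomas 2022, §5.1,
# Lemma 5.4 and Corollary 5.6 for `K = S^k_+`) — PROVED

Source: H. Fawzi, J. Gouveia, P. A. Parrilo, J. Saunderson, R. R. Thomas, *Lifting for simplicity:
concise descriptions of convex sets*, SIAM Review 64 (2022) 866–918 = arXiv:2002.09788
[FawziEtAl2022Lifting], §5.1 "Obstructions based on facial structure" (held text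
`paper:arxiv-2002.09788`, chunks p0023–p0024). The lifts are those of Gouveia–Parrilo–Thomas 2013
[GouveiaParriloThomas2013, Def. 2.1] / Fawzi–Gouveia–Parrilo–Robinson–Thomas 2015 [FawziEtAl2015,
eq. (3)], in the tree's vocabulary `HasPsdLift C k : C = π(S^k_+ ∩ L)` (`PsdLiftSlackMatrix.lean`).

[FawziEtAl2022Lifting, §5.1 p23–p24], verbatim:

> The faces […] of a convex set are partially ordered by inclusion. Throughout this section we
> let `𝓕_C` denote the poset of faces of `C`. If `C = π(Q)` is the projection of a convex set `Q`,
> then the preimage under `π` of any face of `C` is a face of `Q`. […] In general, if `Q` is a lift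
> of `C` then there is an order embedding `φ : 𝓕_C → 𝓕_Q` […] Furthermore, if `Q = K ∩ L` for some
> closed convex cone `K` and affine space `L`, then there is a natural order embedding
> `ψ : 𝓕_Q → 𝓕_K` which sends a face `F` of `Q` to the minimal face of `K` containing `F`. […]
> **5.1.2 Obstructions from chains of faces.** Any order embedding maps a chain of a certain
> length to a chain of the same length, giving the following basic obstruction to the existence
> of lifts.
> **Lemma 5.4.** If `C` is a convex body (of dimension at least one) and `C` has a `K`-lift for a
> closed convex cone `K`, then the longest chain of faces in `C` is strictly smaller than the
> longest chain of faces in `K`.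
> *Proof.* Since `C` is a convex body, it is compact. Since `C` has dimension at least one and is
> compact, it is not a cone. As such, if `C = π(K ∩ L)` then `0 ∉ L`. Therefore, any chain of
> faces in `C` is mapped, by the order embedding `φ`, to a chain of faces of the same length in
> `K` that does not include the face `{0}`. In particular a longest chain of faces in `C` is
> mapped to a chain of faces in `K` that is not of maximum length. □
> […] **Corollary 5.6 ([GPTlifts]).** Any spectrahedral lift of a polytope `C` has size at least
> `dim(C) + 1`. *Proof.* […] the longest chain of non-empty faces in `S^m_+` has length at most
> `m + 1`. This is because the rank (which is constant on the relative interior of faces of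
> `S^m_+`) strictly increases along chains of faces, and the rank is zero on the face `{0}`. □

and Example 5.5 (p24): the convex hull of a cardioid "has a length three chain of non-empty faces"
(a point, a segment, `C`), hence "does not have an `S²_+`-lift".

## What is proved here (`K = S^k_+`; no named facts; faces = convex extreme subsets)

A face of `C` is rendered as a CONVEX subset `F` with Mathlib's `IsExtreme ℝ C F` (the segment
condition; exposedness is not required). For a psd lift `C = π(S^k_+ ∩ L)`:

* `isExtreme_psdLift_preimage` — "the preimage under `π` of any face of `C` is a face of `Q`":
  `{M ∈ S^k_+ ∩ L : π M ∈ F}` is an extreme subset of `S^k_+ ∩ L`.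
* `mem_of_isExtreme_psdLift_of_ker_le` — the rank/kernel mechanism behind "`ψ` sends a face of
  `Q` to the minimal face of `K` containing it": if `G` is an extreme subset of `S^k_+ ∩ L`,
  `X₁ ∈ G`, and `X₂ ∈ S^k_+ ∩ L` has `ker X₁ ⊆ ker X₂`, then `X₂ ∈ G` (the segment from `X₂`
  through `X₁` extends inside `S^k_+ ∩ L` beyond `X₁` by the Ramana–Goldman perturbation of the
  tree's `SpectrahedralConeExtremeRays`, BPT Lemma 4.39).
* `card_le_succ_of_chain_of_faces_of_hasPsdLift` — **Lemma 5.4 / Cor. 5.6 mechanism, psd form, no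
  hypothesis on `C`:** if `C` has a psd lift of size `k`, every chain `F₀ ⊊ F₁ ⊊ ⋯ ⊊ F_{m−1}` of
  nonempty faces of `C` has `m ≤ k + 1` (the minimal kernel dimension over the preimage face
  strictly decreases along the chain: "the rank strictly increases along chains of faces").
* `card_le_of_chain_of_faces_of_hasPsdLift` — **Lemma 5.4 for `K = S^k_+`:** if moreover `C` is
  bounded with two points (so that `0 ∉ L`: "`C` … is not a cone"), then `m ≤ k`; equivalently
  (`not_hasPsdLift_of_chain_of_faces`) a chain of `k + 1` nonempty faces excludes psd lifts of size
  `k` — e.g. a point ⊊ a segment ⊊ `C` excludes `S²_+`-lifts (Example 5.5, the cardioid).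

* `succ_le_of_hasPsdLift_cubeBody` — **Corollary 5.6 for the `n`-cube** `[−1, 1]ⁿ = cubeBody n`
  (`CubeOctahedronDuality`): every psd lift has size `≥ n + 1`, by the chain of `n + 1` nonempty
  faces `{x : x_i = 1 ∀ i ≥ j}`, `j = n, …, 0` ("for a polytope `C`, the dimension strictly increases
  along chains of faces, and any maximal chain of non-empty faces has length `1 + dim(C)`");
  with the standard size-`(n + 1)` lift `[−1, 1]ⁿ = {(X₀₁, …, X₀ₙ) : X ⪰ 0, X_ii = 1 ∀ i}`
  (`hasPsdLift_cubeBody`) this is EXACT: `isLeast_psdLiftSize_cubeBody` — the cube is psd-minimal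
  ("Any `2`-level polytope … is psd-minimal", [FawziEtAl2022Lifting, §5.1.2 p24];
  Gouveia–Robinson–Thomas 2013 Cor. 4.2).

The polytope corollary 5.6 in general (`k ≥ dim C + 1`) is in the tree in its slack-matrix form
(Lee–Theis / FGPRT Cor. 5.9, `PsdRankComparisons.lean`); the general cone version of Lemma 5.4
(face posets of arbitrary `K`) and §5.1.1/§5.1.3 (counting faces, neighborliness) are not typed
here.
-/

noncomputable section

open Matrix Set
open scoped MatrixOrder

namespace Literature.Combinatorics.Optimization

open Literature.LinearAlgebra.Matrix.SpectrahedralConeExtremeRays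
  (exists_smul_sub_posSemidef_of_isHermitian)

variable {k : ℕ}

/-! ### Faces of the lift: preimages of faces, and the kernel step -/

section LiftFaces

variable {E : Type*} [AddCommGroup E] [Module ℝ E]

/-- **"The preimage under `π` of any face of `C` is a face of `Q`"** ([FawziEtAl2022Lifting, §5.1
p23]) for a psd lift `C = π(S^k_+ ∩ L)`: if `F` is an extreme subset of `C`, then
`{M ∈ S^k_+ ∩ L : π M ∈ F}` is an extreme subset of `S^k_+ ∩ L` (the image of an open segment
under the linear `π` is an open segment). [cite: FawziEtAl2022Lifting, §5.1 (p23)] -/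
theorem isExtreme_psdLift_preimage (L : AffineSubspace ℝ (Matrix (Fin k) (Fin k) ℝ))
    (π : Matrix (Fin k) (Fin k) ℝ →ₗ[ℝ] E) {F : Set E}
    (hF : IsExtreme ℝ (π '' {M | M.PosSemidef ∧ M ∈ L}) F) :
    IsExtreme ℝ {M : Matrix (Fin k) (Fin k) ℝ | M.PosSemidef ∧ M ∈ L}
      {M | (M.PosSemidef ∧ M ∈ L) ∧ π M ∈ F} := by
  refine ⟨fun M hM => hM.1, fun X hX Y hY Z hZ hseg => ?_⟩
  obtain ⟨a, b, ha, hb, hab, hZab⟩ := hseg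
  have hπZ : π Z ∈ openSegment ℝ (π X) (π Y) :=
    ⟨a, b, ha, hb, hab, by rw [← hZab, map_add, map_smul, map_smul]⟩
  exact ⟨hX, hF.left_mem_of_mem_openSegment ⟨X, hX, rfl⟩ ⟨Y, hY, rfl⟩ hZ.2 hπZ⟩

/-- **The kernel step** (the mechanism of "`ψ` sends a face `F` of `Q` to the minimal face of `K`
containing `F`", [FawziEtAl2022Lifting, §5.1 p24], for `K = S^k_+` whose faces are cut out by
kernels): if `G` is an extreme subset of the spectrahedron `S^k_+ ∩ L`, `X₁ ∈ G`, and
`X₂ ∈ S^k_+ ∩ L` satisfies `ker X₁ ⊆ ker X₂`, then `X₂ ∈ G`. Indeed by the Ramana–Goldman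
perturbation (tree: `exists_smul_sub_posSemidef_of_isHermitian`, BPT Lemma 4.39) some
`N = X₁ + t(X₁ − X₂)`, `t > 0`, is still psd, so `X₁` lies in the open segment `(N, X₂)` of
`S^k_+ ∩ L`. [cite: FawziEtAl2022Lifting, §5.1 (p24)]
[cite: BlekhermanParriloThomas2012, Ch. 4 §4.6 Lemma 4.39] -/
theorem mem_of_isExtreme_psdLift_of_ker_le {L : AffineSubspace ℝ (Matrix (Fin k) (Fin k) ℝ)}
    {G : Set (Matrix (Fin k) (Fin k) ℝ)} (hG : IsExtreme ℝ {M | M.PosSemidef ∧ M ∈ L} G)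
    {X₁ X₂ : Matrix (Fin k) (Fin k) ℝ} (hX₁ : X₁ ∈ G) (hX₂ : X₂.PosSemidef ∧ X₂ ∈ L)
    (hker : ∀ v, X₁ *ᵥ v = 0 → X₂ *ᵥ v = 0) : X₂ ∈ G := by
  have hX₁K : X₁.PosSemidef ∧ X₁ ∈ L := hG.subset hX₁
  have hB : (X₂ - X₁).IsHermitian := hX₂.1.1.sub hX₁K.1.1
  obtain ⟨c, hc, hpsd⟩ := exists_smul_sub_posSemidef_of_isHermitian hX₁K.1 hB
    (fun v hv => by rw [sub_mulVec, hker v hv, hv, sub_zero])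
  have hc1 : 0 < c + 1 := by linarith
  set t : ℝ := (c + 1)⁻¹ with ht
  have htpos : 0 < t := inv_pos.mpr hc1
  have htc : t * (c + 1) = 1 := inv_mul_cancel₀ hc1.ne'
  -- the point `N = X₁ + t (X₁ − X₂)` beyond `X₁` on the line through `X₂` and `X₁`
  set N : Matrix (Fin k) (Fin k) ℝ := X₁ + t • (X₁ - X₂) with hN
  have hNeq : N = t • ((c • X₁ - (X₂ - X₁)) + X₁) := by
    ext i j
    simp only [hN, Matrix.add_apply, Matrix.smul_apply, Matrix.sub_apply, smul_eq_mul]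
    have : X₁ i j = t * (c + 1) * X₁ i j := by rw [htc, one_mul]
    linear_combination this
  have hNpsd : N.PosSemidef := by
    rw [hNeq]
    exact (hpsd.add hX₁K.1).smul htpos.le
  have hNL : N ∈ L := by
    have h := L.smul_vsub_vadd_mem t hX₁K.2 hX₂.2 hX₁K.2
    rw [vsub_eq_sub, vadd_eq_add, add_comm] at h
    exact h
  -- `X₁` is in the open segment `(N, X₂)`
  have hseg : X₁ ∈ openSegment ℝ N X₂ := by
    refine ⟨(1 + t)⁻¹, t * (1 + t)⁻¹, by positivity, by positivity, ?_, ?_⟩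
    · field_simp
    · rw [hN]
      ext i j
      simp only [Matrix.add_apply, Matrix.smul_apply, Matrix.sub_apply, smul_eq_mul]
      field_simp
      ring
  exact hG.right_mem_of_mem_openSegment ⟨hNpsd, hNL⟩ hX₂ hX₁ hseg

/-- Kernels of sums of psd matrices: `(X + Y) v = 0 ↔ X v = 0 ∧ Y v = 0`. [folklore] -/
private theorem add_mulVec_eq_zero_iff {X Y : Matrix (Fin k) (Fin k) ℝ} (hX : X.PosSemidef)
    (hY : Y.PosSemidef) (v : Fin k → ℝ) : (X + Y) *ᵥ v = 0 ↔ X *ᵥ v = 0 ∧ Y *ᵥ v = 0 := by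
  constructor
  · intro h
    have h0 : star v ⬝ᵥ (X + Y) *ᵥ v = 0 := by rw [h, dotProduct_zero]
    rw [add_mulVec, dotProduct_add] at h0
    have h1 := hX.dotProduct_mulVec_nonneg v
    have h2 := hY.dotProduct_mulVec_nonneg v
    have hx0 : star v ⬝ᵥ X *ᵥ v = 0 := by linarith
    have hy0 : star v ⬝ᵥ Y *ᵥ v = 0 := by linarith
    exact ⟨(hX.dotProduct_mulVec_zero_iff v).mp hx0, (hY.dotProduct_mulVec_zero_iff v).mp hy0⟩
  · rintro ⟨h1, h2⟩
    rw [add_mulVec, h1, h2, add_zero]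

/-- `v ∈ ker (toLin' X)` iff `X v = 0`. [folklore] -/
private theorem mem_ker_toLin'_iff (X : Matrix (Fin k) (Fin k) ℝ) (v : Fin k → ℝ) :
    v ∈ LinearMap.ker (Matrix.toLin' X) ↔ X *ᵥ v = 0 := by
  rw [LinearMap.mem_ker, Matrix.toLin'_apply]

/-- **Minimal kernels on a convex set of psd matrices.** A nonempty convex set `G` of psd
matrices contains an element `X` whose kernel is contained in the kernel of every element of
`G` (an element of maximal rank; take `X` of least kernel dimension and compare with midpoints,
whose kernel is the intersection of the kernels). [folklore] -/
private theorem exists_forall_ker_le {G : Set (Matrix (Fin k) (Fin k) ℝ)} (hGne : G.Nonempty)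
    (hGc : Convex ℝ G) (hGpsd : ∀ X ∈ G, X.PosSemidef) :
    ∃ X ∈ G, ∀ Y ∈ G, ∀ v, X *ᵥ v = 0 → Y *ᵥ v = 0 := by
  classical
  have hP : ∃ n, ∃ X ∈ G, Module.finrank ℝ (LinearMap.ker (Matrix.toLin' X)) = n := by
    obtain ⟨X, hX⟩ := hGne
    exact ⟨_, X, hX, rfl⟩
  obtain ⟨X, hX, hXn⟩ := Nat.find_spec hP
  refine ⟨X, hX, fun Y hY v hv => ?_⟩
  set Z : Matrix (Fin k) (Fin k) ℝ := (1 / 2 : ℝ) • X + (1 / 2 : ℝ) • Y with hZ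
  have hZG : Z ∈ G := hGc hX hY (by norm_num) (by norm_num) (by norm_num)
  have hXh : ((1 / 2 : ℝ) • X).PosSemidef := (hGpsd X hX).smul (by norm_num)
  have hYh : ((1 / 2 : ℝ) • Y).PosSemidef := (hGpsd Y hY).smul (by norm_num)
  have hkerZ : LinearMap.ker (Matrix.toLin' Z) ≤ LinearMap.ker (Matrix.toLin' X) := by
    intro w hw
    rw [mem_ker_toLin'_iff] at hw ⊢
    have h := ((add_mulVec_eq_zero_iff hXh hYh w).mp hw).1
    rw [smul_mulVec] at h
    exact (smul_eq_zero.mp h).resolve_left (by norm_num)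
  have hle : Module.finrank ℝ (LinearMap.ker (Matrix.toLin' X)) ≤
      Module.finrank ℝ (LinearMap.ker (Matrix.toLin' Z)) := by
    rw [hXn]
    exact Nat.find_min' hP ⟨Z, hZG, rfl⟩
  have heq : LinearMap.ker (Matrix.toLin' Z) = LinearMap.ker (Matrix.toLin' X) :=
    Submodule.eq_of_le_of_finrank_eq hkerZ (le_antisymm (Submodule.finrank_mono hkerZ) hle)
  have hvZ : v ∈ LinearMap.ker (Matrix.toLin' Z) := by
    rw [heq, mem_ker_toLin'_iff]
    exact hv
  rw [mem_ker_toLin'_iff] at hvZ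
  have h := ((add_mulVec_eq_zero_iff hXh hYh v).mp hvZ).2
  rw [smul_mulVec] at h
  exact (smul_eq_zero.mp h).resolve_left (by norm_num)

/-! ### Chains of faces -/

/-- **The kernel count along a chain of faces.** For a psd lift `C = π(S^k_+ ∩ L)` and a chain
`F₀ ⊊ ⋯ ⊊ F_{m−1}` of nonempty faces (convex extreme subsets) of `C`, there are representatives
`X_i ∈ S^k_+ ∩ L` with `π X_i ∈ F_i` whose kernel dimensions strictly decrease: `X_i` is an
element of least kernel of the preimage face `F̂_i` (`exists_forall_ker_le`); equality of the
kernel dimensions for `i < j` would put every element of `F̂_j` into `F̂_i` by the kernel step,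
forcing `F_j ⊆ F_i`. ("the rank … strictly increases along chains of faces")
[cite: FawziEtAl2022Lifting, §5.1.2 Lemma 5.4 and Cor. 5.6 proof (p24)] -/
theorem exists_strictAnti_finrank_ker_of_chain_of_faces
    (L : AffineSubspace ℝ (Matrix (Fin k) (Fin k) ℝ)) (π : Matrix (Fin k) (Fin k) ℝ →ₗ[ℝ] E)
    {m : ℕ} {F : Fin m → Set E} (hF : ∀ i, IsExtreme ℝ (π '' {M | M.PosSemidef ∧ M ∈ L}) (F i))
    (hFc : ∀ i, Convex ℝ (F i)) (hne : ∀ i, (F i).Nonempty)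
    (hchain : ∀ ⦃i j : Fin m⦄, i < j → F i ⊂ F j) :
    ∃ X : Fin m → Matrix (Fin k) (Fin k) ℝ, (∀ i, ((X i).PosSemidef ∧ X i ∈ L) ∧ π (X i) ∈ F i) ∧
      ∀ ⦃i j : Fin m⦄, i < j →
        Module.finrank ℝ (LinearMap.ker (Matrix.toLin' (X j))) <
          Module.finrank ℝ (LinearMap.ker (Matrix.toLin' (X i))) := by
  classical
  -- the preimage faces `Ĝ i`
  set G : Fin m → Set (Matrix (Fin k) (Fin k) ℝ) :=
    fun i => {M | (M.PosSemidef ∧ M ∈ L) ∧ π M ∈ F i} with hGdef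
  have hGext : ∀ i, IsExtreme ℝ {M : Matrix (Fin k) (Fin k) ℝ | M.PosSemidef ∧ M ∈ L} (G i) :=
    fun i => isExtreme_psdLift_preimage L π (hF i)
  have hGne : ∀ i, (G i).Nonempty := fun i => by
    obtain ⟨x, hx⟩ := hne i
    obtain ⟨M, hM, hMx⟩ := (hF i).subset hx
    exact ⟨M, hM, by rw [hMx]; exact hx⟩
  have hGc : ∀ i, Convex ℝ (G i) := fun i => by
    intro X hX Y hY a b ha hb hab
    refine ⟨⟨(hX.1.1.smul ha).add (hY.1.1.smul hb), L.convex hX.1.2 hY.1.2 ha hb hab⟩, ?_⟩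
    show π (a • X + b • Y) ∈ F i
    rw [map_add, map_smul, map_smul]
    exact hFc i hX.2 hY.2 ha hb hab
  have hGpsd : ∀ i, ∀ X ∈ G i, X.PosSemidef := fun i X hX => hX.1.1
  -- least-kernel representatives
  choose X hXG hXmin using fun i => exists_forall_ker_le (hGne i) (hGc i) (hGpsd i)
  refine ⟨X, fun i => hXG i, fun i j hij => ?_⟩
  have hsub : F i ⊆ F j := (hchain hij).1
  have hGsub : G i ⊆ G j := fun M hM => ⟨hM.1, hsub hM.2⟩
  have hkerle : LinearMap.ker (Matrix.toLin' (X j)) ≤ LinearMap.ker (Matrix.toLin' (X i)) := by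
    intro v hv
    rw [mem_ker_toLin'_iff] at hv ⊢
    exact hXmin j (X i) (hGsub (hXG i)) v hv
  rcases (Submodule.finrank_mono hkerle).lt_or_eq with hlt | heq
  · exact hlt
  · exfalso
    have hkereq : LinearMap.ker (Matrix.toLin' (X j)) = LinearMap.ker (Matrix.toLin' (X i)) :=
      Submodule.eq_of_le_of_finrank_eq hkerle heq
    -- every element of `Ĝ j` lies in `Ĝ i`, hence `F j ⊆ F i`
    have hGji : G j ⊆ G i := by
      intro Y hY
      refine mem_of_isExtreme_psdLift_of_ker_le (hGext i) (hXG i) hY.1 fun v hv => ?_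
      have hvj : v ∈ LinearMap.ker (Matrix.toLin' (X j)) := by
        rw [hkereq, mem_ker_toLin'_iff]
        exact hv
      rw [mem_ker_toLin'_iff] at hvj
      exact hXmin j Y hY v hvj
    have hFji : F j ⊆ F i := by
      intro x hx
      obtain ⟨M, hM, hMx⟩ := (hF j).subset hx
      have hMG : M ∈ G j := ⟨hM, by rw [hMx]; exact hx⟩
      have h := (hGji hMG).2
      rwa [hMx] at h
    exact (hchain hij).2 hFji

/-- **Chains of faces of a psd-lifted set have at most `k + 1` members** (the mechanism of
[FawziEtAl2022Lifting, Lemma 5.4 / Cor. 5.6] for `K = S^k_+`: "the rank … strictly increases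
along chains of faces" of `S^k_+`). If `C` has a psd lift of size `k` and
`F₀ ⊊ F₁ ⊊ ⋯ ⊊ F_{m−1}` is a chain of nonempty faces of `C` (convex extreme subsets), then
`m ≤ k + 1` — the kernel dimensions of `exists_strictAnti_finrank_ker_of_chain_of_faces` are
`m` distinct numbers in `{0, …, k}`. No hypothesis on `C` (for cones the bound `k + 1` is attained,
e.g. by `C = S^k_+` itself).
[cite: FawziEtAl2022Lifting, §5.1.2 Lemma 5.4 and Cor. 5.6 proof (p24)] -/
theorem card_le_succ_of_chain_of_faces_of_hasPsdLift {C : Set E} (hC : HasPsdLift C k) {m : ℕ}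
    {F : Fin m → Set E} (hF : ∀ i, IsExtreme ℝ C (F i)) (hFc : ∀ i, Convex ℝ (F i))
    (hne : ∀ i, (F i).Nonempty) (hchain : ∀ ⦃i j : Fin m⦄, i < j → F i ⊂ F j) : m ≤ k + 1 := by
  classical
  obtain ⟨L, π, rfl⟩ := hC
  obtain ⟨X, -, hanti⟩ := exists_strictAnti_finrank_ker_of_chain_of_faces L π hF hFc hne hchain
  set d : Fin m → ℕ := fun i => Module.finrank ℝ (LinearMap.ker (Matrix.toLin' (X i))) with hd
  have hdle : ∀ i, d i < k + 1 := fun i => by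
    have h := Submodule.finrank_le (LinearMap.ker (Matrix.toLin' (X i)))
    rw [Module.finrank_fin_fun] at h
    exact Nat.lt_succ_of_le h
  have hinj : Function.Injective fun i : Fin m => (⟨d i, hdle i⟩ : Fin (k + 1)) := by
    intro i j hij
    have hdij : d i = d j := by simpa using hij
    by_contra hne'
    rcases lt_or_gt_of_ne hne' with h | h
    · exact absurd hdij (hanti h).ne'
    · exact absurd hdij (hanti h).ne
  simpa using Fintype.card_le_of_injective _ hinj

end LiftFaces

/-! ### Lemma 5.4 for `S^k_+`: bounded sets are not cones, so `0 ∉ L` and one member is saved -/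

section Bounded

variable {E : Type*} [NormedAddCommGroup E] [NormedSpace ℝ E]

/-- For a bounded set with two points, no psd lift `C = π(S^k_+ ∩ L)` contains the zero matrix
("since `C` has dimension at least one and is compact, it is not a cone. As such, if
`C = π(K ∩ L)` then `0 ∉ L`"): if `0 ∈ S^k_+ ∩ L` then `L` is linear, `C` is closed under
nonnegative scaling, and a nonzero point of `C` would escape every ball.
[cite: FawziEtAl2022Lifting, §5.1.2 Lemma 5.4 proof (p24)] -/
theorem zero_notMem_of_psdLift_of_isBounded (L : AffineSubspace ℝ (Matrix (Fin k) (Fin k) ℝ))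
    (π : Matrix (Fin k) (Fin k) ℝ →ₗ[ℝ] E)
    (hbdd : Bornology.IsBounded (π '' {M | M.PosSemidef ∧ M ∈ L}))
    (hnt : (π '' {M | M.PosSemidef ∧ M ∈ L}).Nontrivial) :
    (0 : Matrix (Fin k) (Fin k) ℝ) ∉ L := by
  intro h0
  obtain ⟨R, hR⟩ := hbdd.exists_norm_le
  -- a nonzero point `π M` of `C`
  obtain ⟨M, hM, hπM⟩ : ∃ M : Matrix (Fin k) (Fin k) ℝ, (M.PosSemidef ∧ M ∈ L) ∧ π M ≠ 0 := by
    obtain ⟨_, ⟨M₁, hM₁, rfl⟩, _, ⟨M₂, hM₂, rfl⟩, hne⟩ := hnt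
    by_cases h₁ : π M₁ = 0
    · refine ⟨M₂, hM₂, fun h₂ => hne ?_⟩
      rw [h₁, h₂]
    · exact ⟨M₁, hM₁, h₁⟩
  -- all its nonnegative multiples lie in `C`
  have hmem : ∀ t : ℝ, 0 ≤ t → t • π M ∈ π '' {M | M.PosSemidef ∧ M ∈ L} := by
    intro t ht
    refine ⟨t • M, ⟨hM.1.smul ht, ?_⟩, by rw [map_smul]⟩
    have h := L.smul_vsub_vadd_mem t hM.2 h0 h0
    rwa [vsub_eq_sub, sub_zero, vadd_eq_add, add_zero] at h
  have hR0 : 0 ≤ R := (norm_nonneg _).trans (hR _ (hmem 1 zero_le_one))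
  have hpos : 0 < ‖π M‖ := norm_pos_iff.mpr hπM
  have ht0 : 0 ≤ (R + 1) / ‖π M‖ := by positivity
  have h := hR _ (hmem ((R + 1) / ‖π M‖) ht0)
  rw [norm_smul, Real.norm_of_nonneg ht0, div_mul_cancel₀ _ hpos.ne'] at h
  linarith

/-- **FGPST Lemma 5.4 for `K = S^k_+`: a bounded convex set with a psd lift of size `k` has no
chain of more than `k` nonempty faces.** If `C ⊆ E` is bounded with two points,
`C = π(S^k_+ ∩ L)`, and `F₀ ⊊ ⋯ ⊊ F_{m−1}` are nonempty faces (convex extreme subsets) of `C`,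
then `m ≤ k` ("the longest chain of faces in `C` is strictly smaller than the longest chain of
faces in `K`"; for `S^k_+` the chains of nonempty faces have at most `k + 1` members and the face
`{0}` is not hit since `0 ∉ L`, `zero_notMem_of_psdLift_of_isBounded`). PROVED here via the
kernel count `exists_strictAnti_finrank_ker_of_chain_of_faces`, all kernels being proper.
[cite: FawziEtAl2022Lifting, §5.1.2 Lemma 5.4 (p24)] -/
theorem card_le_of_chain_of_faces_of_hasPsdLift {C : Set E} (hC : HasPsdLift C k)
    (hbdd : Bornology.IsBounded C) (hnt : C.Nontrivial) {m : ℕ} {F : Fin m → Set E}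
    (hF : ∀ i, IsExtreme ℝ C (F i)) (hFc : ∀ i, Convex ℝ (F i)) (hne : ∀ i, (F i).Nonempty)
    (hchain : ∀ ⦃i j : Fin m⦄, i < j → F i ⊂ F j) : m ≤ k := by
  classical
  obtain ⟨L, π, rfl⟩ := hC
  have h0L : (0 : Matrix (Fin k) (Fin k) ℝ) ∉ L := zero_notMem_of_psdLift_of_isBounded L π hbdd hnt
  obtain ⟨X, hX, hanti⟩ := exists_strictAnti_finrank_ker_of_chain_of_faces L π hF hFc hne hchain
  set d : Fin m → ℕ := fun i => Module.finrank ℝ (LinearMap.ker (Matrix.toLin' (X i))) with hd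
  -- all kernels are proper subspaces since `X i ≠ 0`
  have hdlt : ∀ i, d i < k := fun i => by
    have hXne : X i ≠ 0 := fun h => h0L (by rw [← h]; exact (hX i).1.2)
    have hlt : LinearMap.ker (Matrix.toLin' (X i)) ≠ ⊤ := by
      intro htop
      apply hXne
      have h : Matrix.toLin' (X i) = 0 := LinearMap.ker_eq_top.mp htop
      exact (LinearEquiv.map_eq_zero_iff Matrix.toLin').mp h
    have h := Submodule.finrank_lt hlt
    rwa [Module.finrank_fin_fun] at h
  have hinj : Function.Injective fun i : Fin m => (⟨d i, hdlt i⟩ : Fin k) := by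
    intro i j hij
    have hdij : d i = d j := by simpa using hij
    by_contra hne'
    rcases lt_or_gt_of_ne hne' with h | h
    · exact absurd hdij (hanti h).ne'
    · exact absurd hdij (hanti h).ne
  simpa using Fintype.card_le_of_injective _ hinj

/-- **Obstruction form** ([FawziEtAl2022Lifting, §5.1.2], e.g. Example 5.5: the convex hull of a
cardioid has a chain point ⊊ segment ⊊ `C` of three nonempty faces, hence no `S²_+`-lift): a
bounded convex set with two points that has a chain of `k + 1` nonempty faces has no psd lift of
size `k`. [cite: FawziEtAl2022Lifting, §5.1.2 Lemma 5.4 and Example 5.5 (p24)] -/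
theorem not_hasPsdLift_of_chain_of_faces {C : Set E} (hbdd : Bornology.IsBounded C)
    (hnt : C.Nontrivial) {F : Fin (k + 1) → Set E} (hF : ∀ i, IsExtreme ℝ C (F i))
    (hFc : ∀ i, Convex ℝ (F i)) (hne : ∀ i, (F i).Nonempty)
    (hchain : ∀ ⦃i j : Fin (k + 1)⦄, i < j → F i ⊂ F j) : ¬ HasPsdLift C k := fun hC =>
  absurd (card_le_of_chain_of_faces_of_hasPsdLift hC hbdd hnt hF hFc hne hchain) (by omega)

end Bounded

/-! ### Corollary 5.6 for the cube: every psd lift of `[−1, 1]ⁿ` has size at least `n + 1` -/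

section Cube

open Literature.Analysis.Convex.CubeOctahedronDuality (cubeBody mem_cubeBody_iff)

/-- **FGPST Corollary 5.6 for the `n`-cube** (`n ≥ 1`): any psd lift of `[−1, 1]ⁿ` has size at
least `n + 1` ("for a polytope `C`, the dimension strictly increases along chains of faces, and any
maximal chain of non-empty faces has length `1 + dim(C)`"). The chain used: `F_j = {x ∈ [−1,1]ⁿ :
x_i = 1 for all i ≥ j}`, `j = 0, …, n` — the vertex `(1, …, 1)`, an edge, …, a facet, the cube —
`n + 1` nonempty convex extreme subsets, strictly increasing; then
`card_le_of_chain_of_faces_of_hasPsdLift`. (The bound is attained: the cube is `2`-level, hence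
psd-minimal [FawziEtAl2022Lifting, §5.1.2 after Cor. 5.6]; not reproved here.) PROVED here.
[cite: FawziEtAl2022Lifting, §5.1.2 Cor. 5.6 (p24)] -/
theorem succ_le_of_hasPsdLift_cubeBody {n : ℕ} (hn : 1 ≤ n) (h : HasPsdLift (cubeBody n) k) :
    n + 1 ≤ k := by
  classical
  -- the chain of faces `F j = {x ∈ cube : x_i = 1 for all i ≥ j}`, `j = 0, …, n`
  let F : Fin (n + 1) → Set (Fin n → ℝ) :=
    fun j => {x | x ∈ cubeBody n ∧ ∀ i : Fin n, (j : ℕ) ≤ (i : ℕ) → x i = 1}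
  have hFmem : ∀ (j : Fin (n + 1)) (x : Fin n → ℝ),
      x ∈ F j ↔ x ∈ cubeBody n ∧ ∀ i : Fin n, (j : ℕ) ≤ (i : ℕ) → x i = 1 := fun j x => Iff.rfl
  have hbdd : Bornology.IsBounded (cubeBody n) := by
    refine (Metric.isBounded_closedBall (x := (0 : Fin n → ℝ)) (r := 1)).subset fun x hx => ?_
    rw [mem_closedBall_zero_iff, pi_norm_le_iff_of_nonneg zero_le_one]
    intro i
    rw [Real.norm_eq_abs]
    exact hx i
  have hone : (fun _ : Fin n => (1 : ℝ)) ∈ cubeBody n := fun i => by simp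
  have hzero : (0 : Fin n → ℝ) ∈ cubeBody n := fun i => by simp
  have hnt : (cubeBody n).Nontrivial := by
    refine ⟨fun _ => 1, hone, 0, hzero, fun h01 => ?_⟩
    have := congr_fun h01 ⟨0, hn⟩
    norm_num at this
  have hF : ∀ j, IsExtreme ℝ (cubeBody n) (F j) := by
    intro j
    refine ⟨fun x hx => hx.1, fun x hx y hy z hz hseg => ⟨hx, fun i hi => ?_⟩⟩
    obtain ⟨a, b, ha, hb, hab, hzab⟩ := hseg
    have hzi : a * x i + b * y i = 1 := by
      have := congr_fun hzab i
      simp only [Pi.add_apply, Pi.smul_apply, smul_eq_mul] at this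
      rw [this]
      exact hz.2 i hi
    have hxi : x i ≤ 1 := (abs_le.mp (hx i)).2
    have hyi : y i ≤ 1 := (abs_le.mp (hy i)).2
    nlinarith
  have hFc : ∀ j, Convex ℝ (F j) := by
    intro j x hx y hy a b ha hb hab
    refine ⟨fun i => ?_, fun i hi => ?_⟩
    · have hxi := abs_le.mp (hx.1 i)
      have hyi := abs_le.mp (hy.1 i)
      simp only [Pi.add_apply, Pi.smul_apply, smul_eq_mul]
      rw [abs_le]
      constructor <;> nlinarith
    · simp only [Pi.add_apply, Pi.smul_apply, smul_eq_mul, hx.2 i hi, hy.2 i hi]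
      linarith
  have hne : ∀ j, (F j).Nonempty := fun j => ⟨fun _ => 1, hone, fun _ _ => rfl⟩
  have hchain : ∀ ⦃i j : Fin (n + 1)⦄, i < j → F i ⊂ F j := by
    intro i j hij
    have hij' : (i : ℕ) < (j : ℕ) := hij
    have hjn : (j : ℕ) ≤ n := Nat.lt_succ_iff.mp j.2
    refine ⟨fun x hx => ⟨hx.1, fun l hl => hx.2 l (le_trans hij'.le hl)⟩, fun hsub => ?_⟩
    -- witness in `F j` but not in `F i`: `1` everywhere except `0` at coordinate `i`
    have hin : (i : ℕ) < n := lt_of_lt_of_le hij' hjn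
    let w : Fin n → ℝ := fun l => if (l : ℕ) = (i : ℕ) then 0 else 1
    have hw : w ∈ F j := by
      refine ⟨fun l => ?_, fun l hl => ?_⟩
      · by_cases hl : (l : ℕ) = (i : ℕ) <;> simp [w, hl]
      · have hl' : (l : ℕ) ≠ (i : ℕ) := by omega
        simp [w, hl']
    have hwi := ((hFmem i w).mp (hsub hw)).2 ⟨(i : ℕ), hin⟩ le_rfl
    simp [w] at hwi
  exact card_le_of_chain_of_faces_of_hasPsdLift h hbdd hnt hF hFc hne hchain

/-- In a real psd matrix with unit diagonal every entry has absolute value `≤ 1` (the `2 × 2`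
principal minors). [folklore] -/
private theorem abs_apply_le_one_of_posSemidef_of_diag {m : ℕ} {X : Matrix (Fin m) (Fin m) ℝ}
    (hX : X.PosSemidef) (hdiag : ∀ i, X i i = 1) (p q : Fin m) : |X p q| ≤ 1 := by
  have hsym : X q p = X p q := by
    have h := hX.1.apply q p
    rw [star_trivial] at h
    exact h.symm
  have hquad : ∀ ε : ℝ, 0 ≤ X p p + ε * X p q + ε * X q p + ε * ε * X q q := by
    intro ε
    have h := (hX.submatrix ![p, q]).dotProduct_mulVec_nonneg ![1, ε]
    rw [star_trivial] at h
    simpa [dotProduct, mulVec, Fin.sum_univ_two, Matrix.submatrix_apply, mul_add, add_mul,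
      mul_comm, mul_left_comm, mul_assoc, add_assoc] using h
  have h₁ := hquad 1
  have h₂ := hquad (-1)
  rw [hdiag p, hdiag q, hsym] at h₁ h₂
  rw [abs_le]
  constructor <;> nlinarith

/-- **The standard size-`(n + 1)` psd lift of the `n`-cube** (the first theta-body / sums-of-squares
lift of a `2`-level polytope, [FawziEtAl2022Lifting, §5.1.2 p24]: "Any `2`-level polytope … is
psd-minimal"): `[−1, 1]ⁿ = {(X₀₁, …, X₀ₙ) : X ∈ S^{n+1}_+, X_ii = 1 for all i}`. "`⊇`": the `2 × 2`
minors give `|X₀ᵢ| ≤ 1`; "`⊆`": `X = (1, x)(1, x)ᵀ + diag(0, 1 − x_i²)`. PROVED here.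
[cite: FawziEtAl2022Lifting, §5.1.2 (p24)] [cite: GouveiaRobinsonThomas2013, Cor. 4.2 (p10)] -/
theorem hasPsdLift_cubeBody (n : ℕ) : HasPsdLift (cubeBody n) (n + 1) := by
  classical
  let L : AffineSubspace ℝ (Matrix (Fin (n + 1)) (Fin (n + 1)) ℝ) :=
    { carrier := {X | ∀ i : Fin (n + 1), X i i = 1}
      smul_vsub_vadd_mem' := by
        intro c X₁ X₂ X₃ h₁ h₂ h₃ i
        simp only [Set.mem_setOf_eq] at h₁ h₂ h₃ ⊢
        rw [vsub_eq_sub, vadd_eq_add, Matrix.add_apply, Matrix.smul_apply, Matrix.sub_apply,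
          smul_eq_mul, h₁ i, h₂ i, h₃ i]
        ring }
  have hLmem : ∀ X, X ∈ L ↔ ∀ i : Fin (n + 1), X i i = 1 := fun X => Iff.rfl
  let π : Matrix (Fin (n + 1)) (Fin (n + 1)) ℝ →ₗ[ℝ] (Fin n → ℝ) :=
    { toFun := fun X i => X 0 i.succ
      map_add' := fun X Y => rfl
      map_smul' := fun c X => rfl }
  have hπ : ∀ X (i : Fin n), π X i = X 0 i.succ := fun X i => rfl
  refine ⟨L, π, Set.ext fun x => ⟨fun hx => ?_, ?_⟩⟩
  · -- `X = v vᵀ + diag d`, `v = (1, x)`, `d = (0, 1 − x_i²)`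
    let v : Fin (n + 1) → ℝ := Fin.cons 1 x
    let d : Fin (n + 1) → ℝ := Fin.cons 0 fun i => 1 - x i ^ 2
    have hv0 : v 0 = 1 := rfl
    have hvs : ∀ i : Fin n, v i.succ = x i := fun i => by simp [v]
    have hd0 : d 0 = 0 := rfl
    have hds : ∀ i : Fin n, d i.succ = 1 - x i ^ 2 := fun i => by simp [d]
    have hd : 0 ≤ d := by
      intro i
      show (0 : ℝ) ≤ d i
      refine Fin.cases ?_ (fun j => ?_) i
      · rw [hd0]
      · rw [hds]
        have h := abs_le.mp (hx j)
        nlinarith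
    refine ⟨vecMulVec v v + diagonal d, ⟨?_, (hLmem _).2 fun i => ?_⟩, ?_⟩
    · have h := posSemidef_vecMulVec_self_star (R := ℝ) v
      rw [star_trivial] at h
      exact h.add (PosSemidef.diagonal hd)
    · rw [Matrix.add_apply, vecMulVec_apply, diagonal_apply_eq]
      refine Fin.cases ?_ (fun j => ?_) i
      · rw [hv0, hd0]; ring
      · rw [hvs, hds]; ring
    · funext i
      rw [hπ, Matrix.add_apply, vecMulVec_apply, diagonal_apply_ne _ (Fin.succ_ne_zero i).symm, hv0,
        hvs, one_mul, add_zero]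
  · rintro ⟨X, ⟨hX, hXL⟩, rfl⟩ i
    rw [hπ]
    exact abs_apply_le_one_of_posSemidef_of_diag hX ((hLmem X).1 hXL) 0 i.succ

/-- **The `n`-cube is psd-minimal: its least psd-lift size is exactly `n + 1`** (`n ≥ 1`) —
Gouveia–Robinson–Thomas 2013 Cor. 4.2 ("Let `P` be an `n`-dimensional `2`-level polytope in `ℝⁿ`.
Then the psd rank of `P` is exactly `n+1`") for the cube, in lift form: the lower bound by the chain
of faces (`succ_le_of_hasPsdLift_cubeBody`, FGPST Cor. 5.6), the upper bound by
`hasPsdLift_cubeBody`. PROVED here. [cite: GouveiaRobinsonThomas2013, Cor. 4.2 (p10)]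
[cite: FawziEtAl2022Lifting, §5.1.2 Cor. 5.6 (p24)] -/
theorem isLeast_psdLiftSize_cubeBody {n : ℕ} (hn : 1 ≤ n) :
    IsLeast {k | HasPsdLift (cubeBody n) k} (n + 1) :=
  ⟨hasPsdLift_cubeBody n, fun _ hk => succ_le_of_hasPsdLift_cubeBody hn hk⟩

end Cube

end Literature.Combinatorics.Optimization
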